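import Summits.HodgeConjecture.HodgeConjecture.Theorems.F0P3LettersXiLocalPacketUnitary   -- ★ p823308: the LETTER `XiLocalPacketUnitary` (proved here BY NAME)
import Summits.HodgeConjecture.HodgeConjecture.Theorems.F0P3bSplitMemberUnitarizable     -- ★ p825402: clause (i) `splitMemberGL_isUnitarizable`
import Summits.HodgeConjecture.HodgeConjecture.Theorems.F0P3bSupercuspidalUnitarizable    -- ★ p825442: clause (iii) `isUnitarizable_of_isSupercuspidal`
import Summits.HodgeConjecture.HodgeConjecture.Theorems.F0P3bLocalNonsplitCompactCenter    -- ★ p825600: frame `local_nonsplit_compactOpen_center_of_center_le`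
import Literature.NumberTheory.Automorphic.LocalUnitaryGroupCenter                        -- ★ `forall_mem_center_cmLocal_eq_scalar` («central ⇒ scalar», non-split `v`)
import Literature.NumberTheory.GelbartRogawski1991.XiLocalPacketNonsplitThetaPair         -- ★ p826161: letter D `xiLocalPacket_nonsplit_isThetaPair` + ED. 2 `.pin_of_keysLabels`
import Summits.HodgeConjecture.HodgeConjecture.Theorems.F0P2iGRDWitness                   -- ★ the dictionary pair `(grdMu, grdChi)` of the finite GR dictionary
import Summits.HodgeConjecture.HodgeConjecture.Theorems.F0P3LocalConstituentsUnitary       -- ★ `isUnitarizable_of_injective`, `isUnitarizable_comp`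
import Literature.NumberTheory.Automorphic.Liu2021.Def411WeilCarriersSurvivalNonsplit     -- ★ `compactSpace_localPi_one_of_smul_eq`, `continuous_localCenter`
import Literature.RepresentationTheory.TwistedCoinvariantsCompactIsotypic                 -- ★ `exists_linearEquiv_weightSpace_coinv` (road of stub U1b)
import Literature.RepresentationTheory.TwistedCoinvariantsUnitarizable                     -- ★ p829818 (B-p12 (g26)): U1b `TwistedCoinv.isUnitarizable_rep`
import Summits.HodgeConjecture.HodgeConjecture.Theorems.F0P3bOmegaLocUnitarizable        -- ★ p830233 (B-p12 (g26)): U1a′ `isUnitarizable_omegaLoc_chiLocalSplittingsCM`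
import HarnessLib

/-!
# F0 ∕ P3b — `XiLocalPacketUnitary` FROM THREE NAMED INPUTS, AND FROM THE LETTER D ALONE (sorry-free composition; the importable twin of the Lines workfile `Cruxes/H413/Lines/F0_P3b_KeysPnUnitaryPaydown.lean` ED. 4)
# (cell `hodgecm-mathlib`, crux H413, programme P3b; desk bytes by planner `hodgecm-mathlib-F0P3b-plan-g9`, for the publisher F0P3-plan if the director rules option (b))

WHAT THIS FILE IS.  The `sorry`-FREE part (§2–§4) of the registered pay-down line L1′ «KeysPnUnitary», promoted verbatim to `Theorems/` so that a junction
(K9β `Lines/F0_U3LettersRung1.lean`) can IMPORT it: the head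
  `xiLocalPacketUnitary_of_stubs L H hH hHd μω hμu hres μZ keys hD hU1a hU1b : XiLocalPacketUnitary L H hH hHd μω hμu μZ keys`
proves the LETTER ★ p823308 `XiLocalPacketUnitary` BY NAME from THREE NAMED INPUTS carried as hypotheses — `hD : xiLocalPacket_nonsplit_isThetaPair` (letter D ★ p826161,
booked, T7b pays), `hU1a` (the local Weil representation of the CM splitting package is unitarizable at a unitary splitting character — in-house, S–M), `hU1b` (twisted
coinvariants by a compact group acting smoothly inherit unitarizability — in-house, M, generic) — under the junction's own extras `hres : μω|_{𝕀_{L⁺}} = ω_{L/L⁺}` and the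
`BorelSpace` ∕ `IsHaarMeasure` instances on `U(Φ₃)(L⁺_v) ⧸ Z`.  Clause (i) = ★ p825402, clause (iii) = ★ p825442 at the frame ★ p825600 + ★ `forall_mem_center_cmLocal_eq_scalar`,
clause (ii) = the theta road (letter D at the Keys label for `H = Φ₃` and the rational frame `ᵗS̄ Φ₃ S = diag(2,1,−2)`; `X_v(μ, εn, χ_f)` unitarizable from `hU1a`, `hU1b`;
«irreducible + `X_v`-isotypic ⇒ unitarizable», proved; transport along `localPiEquiv`, `cmDatumLocalCongr`).  See the Lines file's module docstring for the full road and
[Rogawski1990 §12.2 (1)–(2) pp. 173–174, Prop. 13.1.3 (d) p. 199; GelbartRogawski1991 §1.4 pp. 450–451, (5.1.1) p. 465, Lem. 5.1.2 p. 466; MoeglinVignerasWaldspurger1987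
Ch. 2 II.1–II.2; BernsteinZelevinsky1976 §2.3].
v2 (after ★ p830233 ∕ ★ p829818, both B-p12 (g26)): + **`xiLocalPacketUnitary_of_letterD L H hH hHd μω hμu hres μZ keys (hD) : XiLocalPacketUnitary …`** — the ONE-hypothesis
head the rung-0 closer consumes ((V58)(2) + R-33: K9β registers `stub_GR91D : xiLocalPacket_nonsplit_isThetaPair` and passes it as `hD`; `hU1a` ≔ ★ p830233, `hU1b` ≔ ★ p829818 BY NAME).

DEF∕PROOF discipline: theorems only, no `sorry`, no `def`, no instance, no notation; axioms of the head = {propext, Classical.choice, Quot.sound}.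
HONEST LABEL: HC_CM is proved only modulo the 2 remaining named inputs (hLiu418, h413) — behind them the booked printed statements + the MOD package — until rung 0 closes;
this file pays nothing by itself: it turns row #10's open slot (ii) into the three named inputs above.
-/

set_option autoImplicit false

noncomputable section

open NumberField IsDedekindDomain MeasureTheory
open Literature.NumberTheory Literature.NumberTheory.Rogawski1990 Literature.NumberTheory.GaloisRepresentations
open Literature.NumberTheory.Automorphic Literature.NumberTheory.Automorphic.UnitaryGroup
open Literature.NumberTheory.Automorphic.IdeleClassGroup
open Literature.NumberTheory.Automorphic.Liu2021 Literature.NumberTheory.Automorphic.Liu2021.Def411WeilCarriers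
open Literature.NumberTheory.Automorphic.Liu2021.Def411WeilCarriersDoubling
open Literature.NumberTheory.GelbartRogawski1991 Literature.NumberTheory.GelbartRogawski1991.UnitaryDualPair
open Literature.NumberTheory.GelbartRogawski1991.UnitaryDualPair.WeilCoinv
open Literature.NumberTheory.GelbartRogawski1991.GRConstruction
open Literature.RepresentationTheory Literature.RepresentationTheory.Liu2021 Literature.RepresentationTheory.HarrisKudlaSweet1996
open scoped Matrix Classical

namespace Summit.HodgeConjecture.HodgeConjecture.Cruxes.H413.F0P3bXiLocalPacketUnitaryOfStubs

open Summit.HodgeConjecture.HodgeConjecture.Cruxes.H413.F0P3LettersXiLocalPacketUnitary (XiLocalPacketUnitary)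
open Summit.HodgeConjecture.HodgeConjecture.Cruxes.H413.F0P3ClassTokenChoice (isUnitarizable_comap)
open Summit.HodgeConjecture.HodgeConjecture.Cruxes.H413.F0P3LocalConstituentsUnitary (isUnitarizable_of_injective isUnitarizable_comp)
open Summit.HodgeConjecture.HodgeConjecture.Cruxes.H413.F0P2iGRDWitness

/-! ## §2 Proved generic glue: theta type ⇒ unitarizable; smoothness of a restriction; the rational frame of `Φ₃` -/

/-- **An irreducible representation whose `ℂ[G]`-module is `X′`-isotypic, with `X′` unitarizable, is unitarizable** (no irreducibility asked of `X′`):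
`τ.asModule` is simple, so a submodule `m ≅ X′.asModule` is `⊥` or `⊤`; `⊥` would make `X′ = 0` and the isotypic component `⊥ ≠ ⊤`; `⊤` gives an injective
intertwiner `τ → X′`, along which the invariant form restricts (★ `isUnitarizable_of_injective`). [cite: BourbakiAlgebreVIII2012, VIII §4 n°2] [cite: BushnellHenniart2006, §2.6] -/
theorem isUnitarizable_of_isIrreducible_of_isotypicComponent_eq_top {G V T : Type*} [Group G] [AddCommGroup V] [Module ℂ V]
    [AddCommGroup T] [Module ℂ T] {τ : Representation ℂ G T} {σ : Representation ℂ G V} (hτ : τ.IsIrreducible)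
    (htop : isotypicComponent (MonoidAlgebra ℂ G) τ.asModule σ.asModule = ⊤) (hσ : σ.IsUnitarizable) : τ.IsUnitarizable := by
  haveI : IsSimpleModule (MonoidAlgebra ℂ G) τ.asModule := (Representation.irreducible_iff_isSimpleModule_asModule τ).mp hτ
  have hne : ({m : Submodule (MonoidAlgebra ℂ G) τ.asModule | Nonempty (m ≃ₗ[MonoidAlgebra ℂ G] σ.asModule)}).Nonempty := by
    by_contra h0
    rw [Set.not_nonempty_iff_eq_empty] at h0
    have hbot : isotypicComponent (MonoidAlgebra ℂ G) τ.asModule σ.asModule = ⊥ := by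
      rw [isotypicComponent, h0, sSup_empty]
    exact top_ne_bot (htop.symm.trans hbot)
  obtain ⟨m, ⟨em⟩⟩ := hne
  rcases eq_bot_or_eq_top m with hm | hm
  · exfalso
    subst hm
    haveI : Subsingleton σ.asModule := em.symm.toEquiv.subsingleton
    have hle : isotypicComponent (MonoidAlgebra ℂ G) τ.asModule σ.asModule ≤ ⊥ := by
      rw [isotypicComponent]
      refine sSup_le fun m' hm' => ?_
      obtain ⟨e'⟩ := hm'
      haveI : Subsingleton m' := e'.toEquiv.subsingleton
      exact (Submodule.eq_bot_of_subsingleton (p := m')).le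
    have htb : (⊤ : Submodule (MonoidAlgebra ℂ G) τ.asModule) ≤ ⊥ := htop ▸ hle
    exact top_ne_bot (le_bot_iff.mp htb)
  · subst hm
    let e : τ.asModule ≃ₗ[MonoidAlgebra ℂ G] σ.asModule := Submodule.topEquiv.symm.trans em
    let φ : τ.IntertwiningMap σ := (Representation.IntertwiningMap.equivLinearMapAsModule τ σ).symm e.toLinearMap
    have hφinj : Function.Injective φ.toLinearMap := fun a b h => e.injective h
    exact isUnitarizable_of_injective φ.toLinearMap (fun g t => Representation.IntertwiningMap.isIntertwining τ σ φ g t) hφinj hσ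

/-- A representation is isotypic of its own type: `isotypicComponent ℂ[G] M M = ⊤`. [cite: BourbakiAlgebreVIII2012, VIII §4 n°2] -/
theorem isotypicComponent_self_eq_top {R M : Type*} [Ring R] [AddCommGroup M] [Module R M] : isotypicComponent R M M = ⊤ :=
  top_le_iff.mp (((⊤ : Submodule R M).le_isotypicComponent).trans (LinearEquiv.isotypicComponent_eq (Submodule.topEquiv : _ ≃ₗ[R] M)).le)

/-- The restriction of a smooth representation along a continuous homomorphism is smooth (stabilisers pull back to open stabilisers).
[cite: BernsteinZelevinsky1976, §2.1] -/
theorem isSmooth_comp_of_continuous {k G H V : Type*} [CommRing k] [Group G] [Group H] [AddCommGroup V] [Module k V]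
    [TopologicalSpace G] [TopologicalSpace H] {ρ : Representation k G V} (hρ : ρ.IsSmooth) (ι : H →* G) (hι : Continuous ι) :
    Representation.IsSmooth (show Representation k H V from ρ.comp ι) := fun v => by
  have h : ((show Representation k H V from ρ.comp ι).stabilizerSubgroup v : Set H) = ι ⁻¹' (ρ.stabilizerSubgroup v : Set G) := by
    ext h
    simp [Representation.mem_stabilizerSubgroup]
  rw [Representation.isSmoothVector_iff, h]
  exact (hρ v).preimage hι

/-- **The rational diagonalising frame of `Φ₃`**: `S = (e₁+e₃ | e₂ | e₁−e₃) ∈ GL₃(ℚ) ⊂ GL₃(L)` has real non-zero entries and `ᵗS̄ · Φ₃ · S = diag(2, 1, −2)`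
(a theta frame `(e₁, dV, g)` for `H = Φ₃` in the sense of ★ `ThetaTypeAtCM`). [cite: PlatonovRapinchuk1994, §2.3] [cite: Rogawski1990, §12.2 p. 173] -/
theorem exists_qsFrame (L : Type) [Field L] [NumberField L] [IsCMField L] :
    ∃ (dV : Fin 3 → L) (g : GL (Fin 3) L), (∀ i, IsCMField.complexConj L (dV i) = dV i) ∧ (∀ i, dV i ≠ 0) ∧
      ((g : Matrix (Fin 3) (Fin 3) L).map (cmConjRingHom L))ᵀ * qsForm L * (g : Matrix (Fin 3) (Fin 3) L) = Matrix.diagonal dV := by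
  have hdet : Matrix.det (!![1, 0, 1; 0, 1, 0; 1, 0, -1] : Matrix (Fin 3) (Fin 3) L) ≠ 0 := by
    rw [Matrix.det_fin_three]
    simp
    norm_num
  refine ⟨![2, 1, -2], Matrix.GeneralLinearGroup.mkOfDetNeZero _ hdet, ?_, ?_, ?_⟩
  · intro i
    fin_cases i <;> simp
  · intro i
    fin_cases i <;> simp
  · have hmap : (!![1, 0, 1; 0, 1, 0; 1, 0, -1] : Matrix (Fin 3) (Fin 3) L).map (cmConjRingHom L) = !![1, 0, 1; 0, 1, 0; 1, 0, -1] := by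
      ext i j
      fin_cases i <;> fin_cases j <;> simp
    rw [Matrix.GeneralLinearGroup.val_mkOfDetNeZero, hmap]
    ext i j
    fin_cases i <;> fin_cases j <;> simp [Matrix.mul_apply, Fin.sum_univ_three, Matrix.diagonal] <;> norm_num

/-! ## §3 Clause (ii) by the theta road -/

section CM

variable (L : Type) [Field L] [NumberField L] [IsCMField L]

set_option synthInstance.maxHeartbeats 400000 in
set_option maxHeartbeats 8000000 in
/-- **`X_v(μ, ε, χ_f)` is UNITARIZABLE at a NON-split place** (from the stub TEXTS U1a′, U1b): the rank-one factor `U((ε))(L⁺_v) = L_w¹` is COMPACT at a non-split `v`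
(★ `compactSpace_localPi_one_of_smul_eq`), `ω_v ∘ (local centre)` is smooth (★ `isSmooth_omegaLoc`, ★ `continuous_localCenter`), `ω_v` is unitarizable (U1a′ at the
unitary `θ = μ̃`, ★ `isUnitary_toHeckeCharacter`), so the `χ_{f,v}`-coinvariants are (U1b), and so is their restriction along ★ `localLineInl` (★ `isUnitarizable_comp`).
[cite: Liu2021, Def. 4.11 (l. 2090–2096)] [cite: MoeglinVignerasWaldspurger1987, Ch. 2 II.2, Ch. 3 IV] -/
theorem xThetaCM_isUnitarizable
    (hU1a : ∀ (L : Type) [Field L] [NumberField L] [IsCMField L] {n' : ℕ} (e₁ : Fin 3 × Fin 1 ≃ Fin n')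
      (dV : Fin 3 → L) (hdV : ∀ i, IsCMField.complexConj L (dV i) = dV i) (hdV0 : ∀ i, dV i ≠ 0)
      (θ : HeckeCharacter L) (hθ : IsSplittingChar L 1 θ) (hθu : θ.IsUnitary) (ε : (↥(maximalRealSubfield L))ˣ)
      (v : HeightOneSpectrum (𝓞 ↥(maximalRealSubfield L))), ((chiLocalSplittingsCM L e₁ dV hdV hdV0 θ hθ ε).omegaLoc v).IsUnitarizable)
    (hU1b : ∀ {G H S : Type} [Group G] [Group H] [TopologicalSpace H] [IsTopologicalGroup H] [CompactSpace H]
      [AddCommGroup S] [Module ℂ S] {ρW : Representation ℂ H S} (χ : H →* ℂˣ) (ρV : Representation ℂ G S)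
      (hc : ∀ (g : G) (h : H), Commute (ρV g) (ρW h)), ρW.IsSmooth → ρV.IsUnitarizable → (TwistedCoinv.rep χ ρV hc).IsUnitarizable)
    {n' : ℕ} (e₁ : Fin 3 × Fin 1 ≃ Fin n') (dV : Fin 3 → L) (hdV : ∀ i, IsCMField.complexConj L (dV i) = dV i) (hdV0 : ∀ i, dV i ≠ 0)
    (μ : Literature.NumberTheory.Automorphic.IdeleClassGroup L →ₜ* Circle) (hμ : IsConjugateSymplectic L μ)
    (χf : UnitaryGroup.finAdelicOne (↥(maximalRealSubfield L)) L (IsCMField.complexConj L) →* ℂˣ) (ε : (↥(maximalRealSubfield L))ˣ)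
    (v : HeightOneSpectrum (𝓞 ↥(maximalRealSubfield L))) (hns : ∀ w : PlacesOver L v, IsCMField.complexConj L • w.1 = w.1) :
    (xThetaCM L e₁ dV hdV hdV0 μ hμ χf ε v).IsUnitarizable := by
  haveI : Algebra.IsQuadraticExtension ↥(maximalRealSubfield L) L := IsCMField.isQuadraticExtension L
  haveI : CompactSpace (localPi L (IsCMField.complexConj L) 1 (JW (↥(maximalRealSubfield L)) L ε) v) :=
    compactSpace_localPi_one_of_smul_eq (IsCMField.complexConj L) (JW (↥(maximalRealSubfield L)) L ε) (IsCMField.complexConj_ne_one L)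
      (JW_apply_ne_zero (↥(maximalRealSubfield L)) L ε) (Classical.arbitrary (PlacesOver L v)) (hns _)
  exact isUnitarizable_comp
    (hU1b _ _ (commute_omegaLoc_localCenter (↥(maximalRealSubfield L)) L (IsCMField.complexConj L) 3 e₁ (Matrix.diagonal dV)
        (JW (↥(maximalRealSubfield L)) L ε) (complexConj_imagUnit L) (imagUnit_ne_zero L) (imagUnit_mul_self L)
        (realDiagonal_isSymm L dV hdV) (isSymm_TW (↥(maximalRealSubfield L)) ε) (realDiagonal_map L dV hdV).symm
        (JW_eq (↥(maximalRealSubfield L)) L ε) (JW_apply_ne_zero (↥(maximalRealSubfield L)) L ε)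
        (chiLocalSplittingsCM L e₁ dV hdV hdV0 (toHeckeCharacter L μ) ((isOscillatorChar_toHeckeCharacter_iff μ).mpr hμ) ε) v)
      (isSmooth_comp_of_continuous
        ((chiLocalSplittingsCM L e₁ dV hdV hdV0 (toHeckeCharacter L μ) ((isOscillatorChar_toHeckeCharacter_iff μ).mpr hμ) ε).isSmooth_omegaLoc v)
        _ (continuous_localCenter L (IsCMField.complexConj L) n' _ (JW (↥(maximalRealSubfield L)) L ε)
          (JW_apply_ne_zero (↥(maximalRealSubfield L)) L ε) v))
      (hU1a L e₁ dV hdV hdV0 (toHeckeCharacter L μ) ((isOscillatorChar_toHeckeCharacter_iff μ).mpr hμ) (isUnitary_toHeckeCharacter L μ) ε v))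
    _

set_option synthInstance.maxHeartbeats 400000 in
set_option maxHeartbeats 8000000 in
/-- **THETA TYPE ⇒ UNITARIZABLE**: a class `c` of `U(H)(L⁺_v)` which is the theta type `X_v(μ, ε, χ_f) ∘ κ_v⁻¹` (★ `ThetaTypeAtCM`) is unitarizable as soon as
`X_v(μ, ε, χ_f)` is — read at a representative `r` of `c ∘ localPiEquiv` (★ `IrrClass.mk_surjective`; `r.ρ` is a constituent of itself, ★ `isConstituentOf_mk_self`,
and isotypic of its own type, §2), §2 `isUnitarizable_of_isIrreducible_of_isotypicComponent_eq_top`, and back along `localPiEquiv⁻¹` (★ `isUnitarizable_comap`,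
★ `IrrClass.comap_symm_comap`). [cite: GelbartRogawski1991, (5.1.1) p. 465, Lem. 5.1.2 p. 466] [cite: BushnellHenniart2006, §1.1, §2.6] -/
theorem isUnitarizable_of_thetaTypeAtCM {H : Matrix (Fin 3) (Fin 3) L} {n' : ℕ} {e₁ : Fin 3 × Fin 1 ≃ Fin n'} {dV : Fin 3 → L}
    {hdV : ∀ i, IsCMField.complexConj L (dV i) = dV i} {hdV0 : ∀ i, dV i ≠ 0} {g : GL (Fin 3) L}
    {hg : ((g : Matrix (Fin 3) (Fin 3) L).map (cmConjRingHom L))ᵀ * H * (g : Matrix (Fin 3) (Fin 3) L) = Matrix.diagonal dV}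
    {μ : Literature.NumberTheory.Automorphic.IdeleClassGroup L →ₜ* Circle} {hμ : IsConjugateSymplectic L μ}
    {χf : UnitaryGroup.finAdelicOne (↥(maximalRealSubfield L)) L (IsCMField.complexConj L) →* ℂˣ} {ε : (↥(maximalRealSubfield L))ˣ}
    {v : HeightOneSpectrum (𝓞 ↥(maximalRealSubfield L))} {c : IrrClass ((cmDatum L 3 H).Local v)}
    (hθ : ThetaTypeAtCM L H e₁ dV hdV hdV0 g hg μ hμ χf ε v c) (hX : (xThetaCM L e₁ dV hdV hdV0 μ hμ χf ε v).IsUnitarizable) :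
    c.IsUnitarizable := by
  obtain ⟨r, hr⟩ := IrrClass.mk_surjective (IrrClass.comap (localPiEquiv L (IsCMField.complexConj L) 3 H v) c)
  have htop := hθ r.V r.ρ r.isIrreducible (hr ▸ IrrClass.isConstituentOf_mk_self r) r.V r.ρ isotypicComponent_self_eq_top
  have hr_u : r.ρ.IsUnitarizable :=
    isUnitarizable_of_isIrreducible_of_isotypicComponent_eq_top r.isIrreducible htop (isUnitarizable_comp hX _)
  have h1 : (IrrClass.comap (localPiEquiv L (IsCMField.complexConj L) 3 H v) c).IsUnitarizable :=
    hr ▸ (IrrClass.isUnitarizable_mk r).2 hr_u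
  rw [← IrrClass.comap_symm_comap (localPiEquiv L (IsCMField.complexConj L) 3 H v) c]
  exact isUnitarizable_comap _ h1

variable (H : Matrix (Fin 3) (Fin 3) L) (hH : (H.map (cmConjRingHom L))ᵀ = H) (hHd : IsUnit H.det) (μω : HeckeCharacter L) (hμu : μω.IsUnitary)
  (hres : ∀ x : Literature.NumberTheory.GaloisRepresentations.ideleGroup ↥(maximalRealSubfield L),
    μω (AdeleRing.ideleBaseChange (↥(maximalRealSubfield L)) L x) = quadraticHeckeCharCM L x)
  [∀ v : HeightOneSpectrum (𝓞 ↥(maximalRealSubfield L)), MeasurableSpace (Gqs L v ⧸ Subgroup.center (Gqs L v))]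
  [∀ v : HeightOneSpectrum (𝓞 ↥(maximalRealSubfield L)), BorelSpace (Gqs L v ⧸ Subgroup.center (Gqs L v))]
  (μZ : ∀ v : HeightOneSpectrum (𝓞 ↥(maximalRealSubfield L)), Measure (Gqs L v ⧸ Subgroup.center (Gqs L v)))
  [∀ v : HeightOneSpectrum (𝓞 ↥(maximalRealSubfield L)), (μZ v).IsHaarMeasure]
  (keys : ∀ (ξ : OneDimAutRepH L) (v : HeightOneSpectrum (𝓞 ↥(maximalRealSubfield L))),
    (∀ w : PlacesOver L v, IsCMField.complexConj L • w.1 = w.1) →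
      {p : IrrClass (Gqs L v) × IrrClass (Gqs L v) //
        KeysCaseTwoLabels L v (μω.semilocalComponent L v) (torusLocalComponent L (IsCMField.complexConj L) v ξ.η)
          (torusLocalComponent L (IsCMField.complexConj L) v ξ.ψ) p.1 p.2 ∧
        p.1.IsSquareIntegrable (μZ v) ∧ ¬ p.2.IsSquareIntegrable (μZ v)})

include hμu hres

set_option synthInstance.maxHeartbeats 400000 in
set_option maxHeartbeats 8000000 in
/-- **CLAUSE (ii) FROM THE STUB TEXTS — the Keys-labelled `πⁿ(ξ_v)` is UNITARIZABLE at a non-split `v`** (Haar frame, `μω|_{𝕀_{L⁺}} = ω`): letter D at the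
label for `H = Φ₃` and the rational frame of §2 (`T = 1`, `a = 1`, ★ `formCongr_one_eq`) with the dictionary pair `(grdMu, grdChi)` ★ gives
`ThetaTypeAtCM … εn v (πⁿ ∘ e)`; `X_v(μ, εn, χ_f)` is unitarizable (`xThetaCM_isUnitarizable`); hence `πⁿ ∘ e` (`isUnitarizable_of_thetaTypeAtCM`) and `πⁿ`
(★ `isUnitarizable_comap`, ★ `IrrClass.comap_comap_symm`). [cite: GelbartRogawski1991, §1.4 p. 450, Lem. 5.1.2 p. 466] [cite: Rogawski1990, §12.2 (2) p. 174] -/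
theorem keysPn_isUnitarizable_of_stubs (hD : xiLocalPacket_nonsplit_isThetaPair)
    (hU1a : ∀ (L : Type) [Field L] [NumberField L] [IsCMField L] {n' : ℕ} (e₁ : Fin 3 × Fin 1 ≃ Fin n')
      (dV : Fin 3 → L) (hdV : ∀ i, IsCMField.complexConj L (dV i) = dV i) (hdV0 : ∀ i, dV i ≠ 0)
      (θ : HeckeCharacter L) (hθ : IsSplittingChar L 1 θ) (hθu : θ.IsUnitary) (ε : (↥(maximalRealSubfield L))ˣ)
      (v : HeightOneSpectrum (𝓞 ↥(maximalRealSubfield L))), ((chiLocalSplittingsCM L e₁ dV hdV hdV0 θ hθ ε).omegaLoc v).IsUnitarizable)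
    (hU1b : ∀ {G H S : Type} [Group G] [Group H] [TopologicalSpace H] [IsTopologicalGroup H] [CompactSpace H]
      [AddCommGroup S] [Module ℂ S] {ρW : Representation ℂ H S} (χ : H →* ℂˣ) (ρV : Representation ℂ G S)
      (hc : ∀ (g : G) (h : H), Commute (ρV g) (ρW h)), ρW.IsSmooth → ρV.IsUnitarizable → (TwistedCoinv.rep χ ρV hc).IsUnitarizable)
    (ξ : OneDimAutRepH L) (v : HeightOneSpectrum (𝓞 ↥(maximalRealSubfield L))) (hns : ∀ w : PlacesOver L v, IsCMField.complexConj L • w.1 = w.1) :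
    ((keys ξ v hns).1.2).IsUnitarizable := by
  obtain ⟨dV₀, S, hdV₀, hdV₀0, hS⟩ := exists_qsFrame L
  have hcong : formCongr (conjLocal L (IsCMField.complexConj L) v) (1 : GL (Fin 3) (UnitaryGroup.LocalRing L v))
      ((qsForm L).map (algebraMap L (UnitaryGroup.LocalRing L v))) =
      (1 : UnitaryGroup.LocalRing L v) • (Matrix.of fun i j : Fin 3 => if i.val + j.val + 1 = 3 then (1 : L) else 0).map
        (algebraMap L (UnitaryGroup.LocalRing L v)) := by
    rw [formCongr_one_eq, one_smul]
  obtain ⟨εn, hθ⟩ := hD.pin_of_keysLabels L (qsForm L) (antidiagOne_isHermitian L 3) (isUnit_antidiagOne_det L 3)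
    (Equiv.prodUnique (Fin 3) (Fin 1)) dV₀ hdV₀ hdV₀0 S hS ξ μω hμu hres (grdMu L ξ μω hμu) (isConjugateSymplectic_grdMu L ξ μω hμu hres)
    (grdChi L ξ μω hres) (continuous_grdChi L ξ μω hres) (norm_grdChi_apply L ξ hμu hres) (semilocalComponent_toHeckeCharacter_grdMu L ξ μω hμu)
    (fun z => grdChi_finAdelicCheck L ξ μω hres _ z) v hns 1 1 isUnit_one hcong (μZ v) (keys ξ v hns).1.1 (keys ξ v hns).1.2
    (keys ξ v hns).2.1 (keys ξ v hns).2.2.1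
  have hX := xThetaCM_isUnitarizable L hU1a hU1b (Equiv.prodUnique (Fin 3) (Fin 1)) dV₀ hdV₀ hdV₀0 (grdMu L ξ μω hμu)
    (isConjugateSymplectic_grdMu L ξ μω hμu hres) (grdChi L ξ μω hres) εn v hns
  have hc := isUnitarizable_of_thetaTypeAtCM L hθ hX
  rw [← IrrClass.comap_comap_symm (cmDatumLocalCongr L v 1 isUnit_one hcong) (keys ξ v hns).1.2]
  exact isUnitarizable_comap _ hc

/-! ## §4 The kernel-checked composition: the LETTER `XiLocalPacketUnitary` BY NAME, from the stub texts -/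

set_option synthInstance.maxHeartbeats 400000 in
set_option maxHeartbeats 8000000 in
/-- **`XiLocalPacketUnitary` FROM THE STUB TEXTS** (composition, no `sorry`): clause (i) = ★ p825402 transported along `cmSplitEquiv` (★ `cmSplitPacket_πn`,
★ `IrrClass.comap_mk`, ★ `isUnitarizable_comap`) — L1 ED. 5 §2 verbatim; clause (iii) = ★ p825442 at the frame ★ p825600 + ★ `forall_mem_center_cmLocal_eq_scalar`;
clause (ii) = §3 `keysPn_isUnitarizable_of_stubs`. [cite: Rogawski1990, §12.2 (1)–(2) pp. 173–174; §13.1 Prop. 13.1.3 (d) p. 199] [cite: GelbartRogawski1991, Lem. 5.1.2 p. 466] -/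
theorem xiLocalPacketUnitary_of_stubs (hD : xiLocalPacket_nonsplit_isThetaPair)
    (hU1a : ∀ (L : Type) [Field L] [NumberField L] [IsCMField L] {n' : ℕ} (e₁ : Fin 3 × Fin 1 ≃ Fin n')
      (dV : Fin 3 → L) (hdV : ∀ i, IsCMField.complexConj L (dV i) = dV i) (hdV0 : ∀ i, dV i ≠ 0)
      (θ : HeckeCharacter L) (hθ : IsSplittingChar L 1 θ) (hθu : θ.IsUnitary) (ε : (↥(maximalRealSubfield L))ˣ)
      (v : HeightOneSpectrum (𝓞 ↥(maximalRealSubfield L))), ((chiLocalSplittingsCM L e₁ dV hdV hdV0 θ hθ ε).omegaLoc v).IsUnitarizable)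
    (hU1b : ∀ {G H S : Type} [Group G] [Group H] [TopologicalSpace H] [IsTopologicalGroup H] [CompactSpace H]
      [AddCommGroup S] [Module ℂ S] {ρW : Representation ℂ H S} (χ : H →* ℂˣ) (ρV : Representation ℂ G S)
      (hc : ∀ (g : G) (h : H), Commute (ρV g) (ρW h)), ρW.IsSmooth → ρV.IsUnitarizable → (TwistedCoinv.rep χ ρV hc).IsUnitarizable) :
    XiLocalPacketUnitary L H hH hHd μω hμu μZ keys := by
  refine ⟨fun ξ v hs => ?_, fun ξ v hns => keysPn_isUnitarizable_of_stubs L μω hμu hres μZ keys hD hU1a hU1b ξ v hns, fun v hns c hc => ?_⟩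
  · rw [cmSplitPacket_πn, ← IrrClass.comap_mk]
    exact isUnitarizable_comap _ ((IrrClass.isUnitarizable_mk _).2
      (F0P3bSplitMemberUnitarizable.splitMemberGL_isUnitarizable _ _ _ _ _ _ _))   -- ★ p825402
  · obtain ⟨⟨K₀, hK₀o, hK₀c⟩, hZ⟩ := F0P3bLocalNonsplitCompactCenter.local_nonsplit_compactOpen_center_of_center_le L 3 H hHd v hns
      (UnitaryGroup.forall_mem_center_cmLocal_eq_scalar L H hH hHd v hns)   -- ★ p825600 + ★ `LocalUnitaryGroupCenter`
    exact F0P3bSupercuspidalUnitarizable.isUnitarizable_of_isSupercuspidal hK₀o hK₀c hZ c hc   -- ★ p825442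

/-- **The letter from the LETTER D ALONE — the one-hypothesis head for the rung-0 closer** ((V58)(2) + R-33: K9β registers
`stub_GR91D : GelbartRogawski1991.xiLocalPacket_nonsplit_isThetaPair` and feeds it here; U1a′ and U1b are discharged BY NAME by ★ p830233
`F0P3bOmegaLocUnitarizable.isUnitarizable_omegaLoc_chiLocalSplittingsCM` and ★ p829818 `TwistedCoinv.isUnitarizable_rep`). Axioms: TRIO (the hypothesis `hD` is the
only printed input). [cite: Rogawski1990, §12.2 (1)–(2) pp. 173–174; §13.1 Prop. 13.1.3 (d) p. 199] [cite: GelbartRogawski1991, Lem. 5.1.2 p. 466] -/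
theorem xiLocalPacketUnitary_of_letterD (hD : xiLocalPacket_nonsplit_isThetaPair) :
    XiLocalPacketUnitary L H hH hHd μω hμu μZ keys :=
  xiLocalPacketUnitary_of_stubs L H hH hHd μω hμu hres μZ keys hD
    (fun L _ _ _ _ e₁ dV hdV hdV0 θ hθ hθu ε v =>
      F0P3bOmegaLocUnitarizable.isUnitarizable_omegaLoc_chiLocalSplittingsCM L e₁ dV hdV hdV0 θ hθ hθu ε v)   -- ★ p830233 (U1a′)
    (fun χ ρV hc hsm hρV => TwistedCoinv.isUnitarizable_rep χ ρV hc hsm hρV)                                   -- ★ p829818 (U1b)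

end CM

end Summit.HodgeConjecture.HodgeConjecture.Cruxes.H413.F0P3bXiLocalPacketUnitaryOfStubs

end
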